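import Summits.CriticalPhenomena.PercolationContinuityZ3.Theorems.PercNearOneGluingNoHeavyLowerTailSuperTerminalP3LamPortPieces
import Summits.CriticalPhenomena.PercolationContinuityZ3.Theorems.PercNearOneGluingNoHeavyLowerTailSuperTerminalP3LamPortTermPairs
import HarnessLib

/-!
# `P3_λ` (`λ ≥ 3/2`): pieces touching the port and AT MOST ONE terminal are irrelevant too

Support file for crux `stmt-CriticalPhenomena-4575` (`NoHeavyLowerTail`), seat `prim-l12-p1` gen 33 (`--supports stmt-CriticalPhenomena-4575`);
sequel of `…SuperTerminalP3LamPortPieces` (pieces NOT adjacent to the port) and `…SuperTerminalP3LamPortTermPairs` (port–terminal pairs).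
No definitions, no sorries, standard axioms.

Row `P3_λ`: `μ(F)·μ(c ↔ T) ≤ λ·μ(F ∩ c ↔ T)`, `F = {s↔a} ∩ {s↮b}`, `T = {s,a,b}` (sharp conjectured constant `λ = 3/2`).  A piece touching `c`
and at most ONE of `s, a, b` has the down-set vector of a single port–terminal pair (`dvec_csPiece`, `dvec_caPiece`, `dvec_cbPiece`: the two
untouched terminals are a.s. isolated in it), so the pencil lemmas `dvec_p3lam_{cs,ca,cb}Pair` (`λ ≥ 4/3`, order relations only) glue it.

MAIN THEOREM (`p3lam_of_portPieces₂`).  For `λ ≥ 3/2`, a splitting `part : V → ι` at `{s,a,b,c}` and a label set `J` such that every piece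
outside `J` misses the port, or misses `{s,a}`, or misses `{s,b}`, or misses `{a,b}`: `P3_λ(w_J) ⟹ P3_λ(w)` (`w_J = w·1_{terminal pairs ∪ pieces of J}`).
So **a counterexample to the sharp row `P3_{3/2}` with the fewest active vertices is a union of `{s,a,b,c}`-pieces each of which touches the port
AND at least two of `s, a, b`** (plus, by `…PortTermPairs` / `…PortPart`, no pair inside `{s,a,b,c}`).
-/

namespace Summit.CriticalPhenomena.PercolationContinuityZ3.Theorems.SuperTerminalP3LamPortPiecesTwo

open MeasureTheory Set Filter
open Literature.Probability.Percolation Literature.Probability.Percolation.PartitionGluing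
open Literature.Probability.LatticeModels (prodBernoulli)
open SuperTerminalDownsets SuperTerminalDownsetEvents SuperTerminalP3LamDvec SuperTerminalP3LamPortPieces SuperTerminalP3LamPortTermPairs
open scoped Classical

variable {V : Type*} [Fintype V]

/-- The row `P3_λ` in down-set coordinates (as in `…SuperTerminalP3LamDvec`).  Local notation only. -/
local notation "RowLam[" lam ";" x0 "," x1 "," x2 "," x3 "," x4 "," x5 "," x6 "," x7 "]" =>
  (((x2 - x3 + x4 - x5 - x6 - x1 + 2 * x0) * (1 - x7) ≤ lam * (x2 - x3 + x4 - x5 - x6 - 2 * x1 + 3 * x0)) : Prop)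

/-! ## Cell algebra wrappers: gluing a vector of port–terminal-pair shape -/

/-- Gluing a vector of `cs`-pair shape `(ρ,ρ,ρ,ρ,1,1,ρ,ρ)` (`ρ = e7`). [this work] -/
theorem dvec_p3lam_mul_csShape {lam d0 d1 d2 d3 d4 d5 d6 d7 e0 e1 e2 e3 e4 e5 e6 e7 : ℝ} (hlam : 4 / 3 ≤ lam)
    (hd : (0 : ℝ) ≤ d0 ∧ d0 ≤ d1 ∧ d0 ≤ d3 ∧ d0 ≤ d5 ∧ d0 ≤ d6 ∧ (0 : ℝ) ≤ d7 ∧ d7 ≤ 1 ∧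
      (0 : ℝ) ≤ d2 - d3 - d1 + d0 ∧ (0 : ℝ) ≤ d4 - d5 - d6 + d0 - d1 + d0)
    (hP : RowLam[lam; d0, d1, d2, d3, d4, d5, d6, d7])
    (h0 : e0 = e7) (h1 : e1 = e7) (h2 : e2 = e7) (h3 : e3 = e7) (h4 : e4 = 1) (h5 : e5 = 1) (h6 : e6 = e7)
    (he0 : 0 ≤ e7) (he1 : e7 ≤ 1) :
    RowLam[lam; d0 * e0, d1 * e1, d2 * e2, d3 * e3, d4 * e4, d5 * e5, d6 * e6, d7 * e7] := by
  rw [h0, h1, h2, h3, h4, h5, h6]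
  have key := dvec_p3lam_csPair (ρ := e7) hlam hd hP he0 he1
  convert key using 2 <;> ring

/-- Gluing a vector of `ca`-pair shape `(ρ,ρ,ρ,ρ,1,ρ,1,ρ)` (`ρ = e7`). [this work] -/
theorem dvec_p3lam_mul_caShape {lam d0 d1 d2 d3 d4 d5 d6 d7 e0 e1 e2 e3 e4 e5 e6 e7 : ℝ} (hlam : 4 / 3 ≤ lam)
    (hd : (0 : ℝ) ≤ d0 ∧ d0 ≤ d1 ∧ d0 ≤ d3 ∧ d0 ≤ d5 ∧ d0 ≤ d6 ∧ (0 : ℝ) ≤ d7 ∧ d7 ≤ 1 ∧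
      (0 : ℝ) ≤ d2 - d3 - d1 + d0 ∧ (0 : ℝ) ≤ d4 - d5 - d6 + d0 - d1 + d0)
    (hP : RowLam[lam; d0, d1, d2, d3, d4, d5, d6, d7])
    (h0 : e0 = e7) (h1 : e1 = e7) (h2 : e2 = e7) (h3 : e3 = e7) (h4 : e4 = 1) (h5 : e5 = e7) (h6 : e6 = 1)
    (he0 : 0 ≤ e7) (he1 : e7 ≤ 1) :
    RowLam[lam; d0 * e0, d1 * e1, d2 * e2, d3 * e3, d4 * e4, d5 * e5, d6 * e6, d7 * e7] := by
  rw [h0, h1, h2, h3, h4, h5, h6]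
  have key := dvec_p3lam_caPair (ρ := e7) hlam hd hP he0 he1
  convert key using 2 <;> ring

/-- Gluing a vector of `cb`-pair shape `(ρ,ρ,1,1,ρ,ρ,ρ,ρ)` (`ρ = e7`). [this work] -/
theorem dvec_p3lam_mul_cbShape {lam d0 d1 d2 d3 d4 d5 d6 d7 e0 e1 e2 e3 e4 e5 e6 e7 : ℝ} (hlam : 4 / 3 ≤ lam)
    (hd : (0 : ℝ) ≤ d0 ∧ d0 ≤ d1 ∧ d0 ≤ d3 ∧ d0 ≤ d5 ∧ d0 ≤ d6 ∧ (0 : ℝ) ≤ d7 ∧ d7 ≤ 1 ∧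
      (0 : ℝ) ≤ d2 - d3 - d1 + d0 ∧ (0 : ℝ) ≤ d4 - d5 - d6 + d0 - d1 + d0)
    (hP : RowLam[lam; d0, d1, d2, d3, d4, d5, d6, d7])
    (h0 : e0 = e7) (h1 : e1 = e7) (h2 : e2 = 1) (h3 : e3 = 1) (h4 : e4 = e7) (h5 : e5 = e7) (h6 : e6 = e7)
    (he0 : 0 ≤ e7) (he1 : e7 ≤ 1) :
    RowLam[lam; d0 * e0, d1 * e1, d2 * e2, d3 * e3, d4 * e4, d5 * e5, d6 * e6, d7 * e7] := by
  rw [h0, h1, h2, h3, h4, h5, h6]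
  have key := dvec_p3lam_cbPair (ρ := e7) hlam hd hP he0 he1
  convert key using 2 <;> ring

/-! ## The down-set vector of a piece touching the port and at most one terminal -/

section Shapes
variable {s a b c : V}

omit [Fintype V] in
/-- `μ.real` of two a.e.-equal events (by a pointwise equivalence off a null set). [folklore] -/
theorem real_congr_of_ae (u : Sym2 V → unitInterval) {X Y : Set (BondConfig V)}
    (h : ∀ᵐ ω ∂(prodBernoulli u), ω ∈ X ↔ ω ∈ Y) : (prodBernoulli u).real X = (prodBernoulli u).real Y :=
  measureReal_congr (Filter.eventuallyEq_set.2 h)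

omit [Fintype V] in
/-- An a.s. sure event has probability one. [folklore] -/
theorem real_eq_one_of_ae (u : Sym2 V → unitInterval) {X : Set (BondConfig V)} (h : ∀ᵐ ω ∂(prodBernoulli u), ω ∈ X) :
    (prodBernoulli u).real X = 1 := by
  rw [← probReal_univ (μ := prodBernoulli u)]
  exact real_congr_of_ae u (by filter_upwards [h] with ω hω; simp only [mem_univ, iff_true]; exact hω)

/-- A vertex all of whose pairs have weight `0` is a.s. separated from any other vertex (both orientations). [folklore] -/
theorem ae_sep_of_isolated (u : Sym2 V → unitInterval) {z v : V} (hz : ∀ x : V, x ≠ z → (u s(z, x) : ℝ) = 0) (hv : v ≠ z) :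
    ∀ᵐ ω ∂(prodBernoulli u), ¬ (openGraph ω).Reachable z v ∧ ¬ (openGraph ω).Reachable v z := by
  have h0 := measure_eq_zero_iff_ae_notMem.1
    ((measureReal_eq_zero_iff (by finiteness)).1 (real_openConn_eq_zero_of_portIsolated u hz hv))
  filter_upwards [h0] with ω hω
  simp only [openConn, mem_setOf_eq] at hω
  exact ⟨hω, fun h => hω h.symm⟩

/-- **`cb`-shape**: if the pairs of `u` avoid `s` and `a`, then `d0 = d1 = d4 = d5 = d6 = d7` and `d2 = d3 = 1` (`d7 = P_u(c ↮ b)`). [this work] -/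
theorem dvec_cbPiece (u : Sym2 V → unitInterval) (hd : s ≠ a ∧ s ≠ b ∧ s ≠ c ∧ a ≠ b ∧ a ≠ c ∧ b ≠ c)
    (hs : ∀ x : V, x ≠ s → (u s(s, x) : ℝ) = 0) (ha : ∀ x : V, x ≠ a → (u s(a, x) : ℝ) = 0) :
    (prodBernoulli u).real ((openConn s a)ᶜ ∩ (openConn s b)ᶜ ∩ (openConn s c)ᶜ ∩ (openConn a b)ᶜ ∩ (openConn a c)ᶜ ∩ (openConn b c)ᶜ : Set (BondConfig V)) =
        (prodBernoulli u).real ((openConn c s)ᶜ ∩ (openConn c a)ᶜ ∩ (openConn c b)ᶜ : Set (BondConfig V)) ∧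
      (prodBernoulli u).real ((openConn s b)ᶜ ∩ (openConn s c)ᶜ ∩ (openConn a b)ᶜ ∩ (openConn a c)ᶜ ∩ (openConn b c)ᶜ : Set (BondConfig V)) =
        (prodBernoulli u).real ((openConn c s)ᶜ ∩ (openConn c a)ᶜ ∩ (openConn c b)ᶜ : Set (BondConfig V)) ∧
      (prodBernoulli u).real ((openConn s b)ᶜ ∩ (openConn s c)ᶜ ∩ (openConn a b)ᶜ ∩ (openConn a c)ᶜ : Set (BondConfig V)) = 1 ∧
      (prodBernoulli u).real ((openConn s a)ᶜ ∩ (openConn s b)ᶜ ∩ (openConn s c)ᶜ ∩ (openConn a b)ᶜ ∩ (openConn a c)ᶜ : Set (BondConfig V)) = 1 ∧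
      (prodBernoulli u).real ((openConn s b)ᶜ ∩ (openConn a b)ᶜ ∩ (openConn b c)ᶜ : Set (BondConfig V)) =
        (prodBernoulli u).real ((openConn c s)ᶜ ∩ (openConn c a)ᶜ ∩ (openConn c b)ᶜ : Set (BondConfig V)) ∧
      (prodBernoulli u).real ((openConn s a)ᶜ ∩ (openConn s b)ᶜ ∩ (openConn a b)ᶜ ∩ (openConn a c)ᶜ ∩ (openConn b c)ᶜ : Set (BondConfig V)) =
        (prodBernoulli u).real ((openConn c s)ᶜ ∩ (openConn c a)ᶜ ∩ (openConn c b)ᶜ : Set (BondConfig V)) ∧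
      (prodBernoulli u).real ((openConn s a)ᶜ ∩ (openConn s b)ᶜ ∩ (openConn s c)ᶜ ∩ (openConn a b)ᶜ ∩ (openConn b c)ᶜ : Set (BondConfig V)) =
        (prodBernoulli u).real ((openConn c s)ᶜ ∩ (openConn c a)ᶜ ∩ (openConn c b)ᶜ : Set (BondConfig V)) := by
  have hae : ∀ᵐ ω ∂(prodBernoulli u), (¬ (openGraph ω).Reachable s a ∧ ¬ (openGraph ω).Reachable a s) ∧
      (¬ (openGraph ω).Reachable s b ∧ ¬ (openGraph ω).Reachable b s) ∧ (¬ (openGraph ω).Reachable s c ∧ ¬ (openGraph ω).Reachable c s) ∧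
      (¬ (openGraph ω).Reachable a b ∧ ¬ (openGraph ω).Reachable b a) ∧ (¬ (openGraph ω).Reachable a c ∧ ¬ (openGraph ω).Reachable c a) := by
    filter_upwards [ae_sep_of_isolated u hs hd.1.symm, ae_sep_of_isolated u hs hd.2.1.symm, ae_sep_of_isolated u hs hd.2.2.1.symm,
      ae_sep_of_isolated u ha hd.2.2.2.1.symm, ae_sep_of_isolated u ha hd.2.2.2.2.1.symm] with ω h1 h2 h3 h4 h5
    exact ⟨h1, h2, h3, h4, h5⟩
  have Y : ∀ X : Set (BondConfig V), (∀ ω : BondConfig V, ((¬ (openGraph ω).Reachable s a ∧ ¬ (openGraph ω).Reachable a s) ∧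
      (¬ (openGraph ω).Reachable s b ∧ ¬ (openGraph ω).Reachable b s) ∧ (¬ (openGraph ω).Reachable s c ∧ ¬ (openGraph ω).Reachable c s) ∧
      (¬ (openGraph ω).Reachable a b ∧ ¬ (openGraph ω).Reachable b a) ∧ (¬ (openGraph ω).Reachable a c ∧ ¬ (openGraph ω).Reachable c a)) →
      (ω ∈ X ↔ ¬ (openGraph ω).Reachable c b)) →
      (prodBernoulli u).real X = (prodBernoulli u).real ((openConn c s)ᶜ ∩ (openConn c a)ᶜ ∩ (openConn c b)ᶜ : Set (BondConfig V)) := by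
    intro X hX
    refine real_congr_of_ae u ?_
    filter_upwards [hae] with ω hω
    rw [hX ω hω]
    simp only [mem_inter_iff, mem_compl_iff, openConn, mem_setOf_eq]
    tauto
  have O : ∀ X : Set (BondConfig V), (∀ ω : BondConfig V, ((¬ (openGraph ω).Reachable s a ∧ ¬ (openGraph ω).Reachable a s) ∧
      (¬ (openGraph ω).Reachable s b ∧ ¬ (openGraph ω).Reachable b s) ∧ (¬ (openGraph ω).Reachable s c ∧ ¬ (openGraph ω).Reachable c s) ∧
      (¬ (openGraph ω).Reachable a b ∧ ¬ (openGraph ω).Reachable b a) ∧ (¬ (openGraph ω).Reachable a c ∧ ¬ (openGraph ω).Reachable c a)) →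
      ω ∈ X) → (prodBernoulli u).real X = 1 := fun X hX =>
    real_eq_one_of_ae u (by filter_upwards [hae] with ω hω; exact hX ω hω)
  have hbc : ∀ ω : BondConfig V, (openGraph ω).Reachable b c ↔ (openGraph ω).Reachable c b := fun ω => ⟨fun h => h.symm, fun h => h.symm⟩
  refine ⟨Y _ ?_, Y _ ?_, O _ ?_, O _ ?_, Y _ ?_, Y _ ?_, Y _ ?_⟩ <;> intro ω hω <;>
    simp only [mem_inter_iff, mem_compl_iff, openConn, mem_setOf_eq, hbc ω] <;> tauto

/-- **`cs`-shape**: if the pairs of `u` avoid `a` and `b`, then `d0 = d1 = d2 = d3 = d6 = d7` and `d4 = d5 = 1` (`d7 = P_u(c ↮ s)`). [this work] -/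
theorem dvec_csPiece (u : Sym2 V → unitInterval) (hd : s ≠ a ∧ s ≠ b ∧ s ≠ c ∧ a ≠ b ∧ a ≠ c ∧ b ≠ c)
    (ha : ∀ x : V, x ≠ a → (u s(a, x) : ℝ) = 0) (hb : ∀ x : V, x ≠ b → (u s(b, x) : ℝ) = 0) :
    (prodBernoulli u).real ((openConn s a)ᶜ ∩ (openConn s b)ᶜ ∩ (openConn s c)ᶜ ∩ (openConn a b)ᶜ ∩ (openConn a c)ᶜ ∩ (openConn b c)ᶜ : Set (BondConfig V)) =
        (prodBernoulli u).real ((openConn c s)ᶜ ∩ (openConn c a)ᶜ ∩ (openConn c b)ᶜ : Set (BondConfig V)) ∧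
      (prodBernoulli u).real ((openConn s b)ᶜ ∩ (openConn s c)ᶜ ∩ (openConn a b)ᶜ ∩ (openConn a c)ᶜ ∩ (openConn b c)ᶜ : Set (BondConfig V)) =
        (prodBernoulli u).real ((openConn c s)ᶜ ∩ (openConn c a)ᶜ ∩ (openConn c b)ᶜ : Set (BondConfig V)) ∧
      (prodBernoulli u).real ((openConn s b)ᶜ ∩ (openConn s c)ᶜ ∩ (openConn a b)ᶜ ∩ (openConn a c)ᶜ : Set (BondConfig V)) =
        (prodBernoulli u).real ((openConn c s)ᶜ ∩ (openConn c a)ᶜ ∩ (openConn c b)ᶜ : Set (BondConfig V)) ∧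
      (prodBernoulli u).real ((openConn s a)ᶜ ∩ (openConn s b)ᶜ ∩ (openConn s c)ᶜ ∩ (openConn a b)ᶜ ∩ (openConn a c)ᶜ : Set (BondConfig V)) =
        (prodBernoulli u).real ((openConn c s)ᶜ ∩ (openConn c a)ᶜ ∩ (openConn c b)ᶜ : Set (BondConfig V)) ∧
      (prodBernoulli u).real ((openConn s b)ᶜ ∩ (openConn a b)ᶜ ∩ (openConn b c)ᶜ : Set (BondConfig V)) = 1 ∧
      (prodBernoulli u).real ((openConn s a)ᶜ ∩ (openConn s b)ᶜ ∩ (openConn a b)ᶜ ∩ (openConn a c)ᶜ ∩ (openConn b c)ᶜ : Set (BondConfig V)) = 1 ∧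
      (prodBernoulli u).real ((openConn s a)ᶜ ∩ (openConn s b)ᶜ ∩ (openConn s c)ᶜ ∩ (openConn a b)ᶜ ∩ (openConn b c)ᶜ : Set (BondConfig V)) =
        (prodBernoulli u).real ((openConn c s)ᶜ ∩ (openConn c a)ᶜ ∩ (openConn c b)ᶜ : Set (BondConfig V)) := by
  have hae : ∀ᵐ ω ∂(prodBernoulli u), (¬ (openGraph ω).Reachable a s ∧ ¬ (openGraph ω).Reachable s a) ∧
      (¬ (openGraph ω).Reachable a b ∧ ¬ (openGraph ω).Reachable b a) ∧ (¬ (openGraph ω).Reachable a c ∧ ¬ (openGraph ω).Reachable c a) ∧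
      (¬ (openGraph ω).Reachable b s ∧ ¬ (openGraph ω).Reachable s b) ∧ (¬ (openGraph ω).Reachable b c ∧ ¬ (openGraph ω).Reachable c b) := by
    filter_upwards [ae_sep_of_isolated u ha hd.1, ae_sep_of_isolated u ha hd.2.2.2.1.symm, ae_sep_of_isolated u ha hd.2.2.2.2.1.symm,
      ae_sep_of_isolated u hb hd.2.1, ae_sep_of_isolated u hb hd.2.2.2.2.2.symm] with ω h1 h2 h3 h4 h5
    exact ⟨h1, h2, h3, h4, h5⟩
  have Y : ∀ X : Set (BondConfig V), (∀ ω : BondConfig V, ((¬ (openGraph ω).Reachable a s ∧ ¬ (openGraph ω).Reachable s a) ∧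
      (¬ (openGraph ω).Reachable a b ∧ ¬ (openGraph ω).Reachable b a) ∧ (¬ (openGraph ω).Reachable a c ∧ ¬ (openGraph ω).Reachable c a) ∧
      (¬ (openGraph ω).Reachable b s ∧ ¬ (openGraph ω).Reachable s b) ∧ (¬ (openGraph ω).Reachable b c ∧ ¬ (openGraph ω).Reachable c b)) →
      (ω ∈ X ↔ ¬ (openGraph ω).Reachable c s)) →
      (prodBernoulli u).real X = (prodBernoulli u).real ((openConn c s)ᶜ ∩ (openConn c a)ᶜ ∩ (openConn c b)ᶜ : Set (BondConfig V)) := by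
    intro X hX
    refine real_congr_of_ae u ?_
    filter_upwards [hae] with ω hω
    rw [hX ω hω]
    simp only [mem_inter_iff, mem_compl_iff, openConn, mem_setOf_eq]
    tauto
  have O : ∀ X : Set (BondConfig V), (∀ ω : BondConfig V, ((¬ (openGraph ω).Reachable a s ∧ ¬ (openGraph ω).Reachable s a) ∧
      (¬ (openGraph ω).Reachable a b ∧ ¬ (openGraph ω).Reachable b a) ∧ (¬ (openGraph ω).Reachable a c ∧ ¬ (openGraph ω).Reachable c a) ∧
      (¬ (openGraph ω).Reachable b s ∧ ¬ (openGraph ω).Reachable s b) ∧ (¬ (openGraph ω).Reachable b c ∧ ¬ (openGraph ω).Reachable c b)) →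
      ω ∈ X) → (prodBernoulli u).real X = 1 := fun X hX =>
    real_eq_one_of_ae u (by filter_upwards [hae] with ω hω; exact hX ω hω)
  have hsc : ∀ ω : BondConfig V, (openGraph ω).Reachable s c ↔ (openGraph ω).Reachable c s := fun ω => ⟨fun h => h.symm, fun h => h.symm⟩
  refine ⟨Y _ ?_, Y _ ?_, Y _ ?_, Y _ ?_, O _ ?_, O _ ?_, Y _ ?_⟩ <;> intro ω hω <;>
    simp only [mem_inter_iff, mem_compl_iff, openConn, mem_setOf_eq, hsc ω] <;> tauto

/-- **`ca`-shape**: if the pairs of `u` avoid `s` and `b`, then `d0 = d1 = d2 = d3 = d5 = d7` and `d4 = d6 = 1` (`d7 = P_u(c ↮ a)`). [this work] -/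
theorem dvec_caPiece (u : Sym2 V → unitInterval) (hd : s ≠ a ∧ s ≠ b ∧ s ≠ c ∧ a ≠ b ∧ a ≠ c ∧ b ≠ c)
    (hs : ∀ x : V, x ≠ s → (u s(s, x) : ℝ) = 0) (hb : ∀ x : V, x ≠ b → (u s(b, x) : ℝ) = 0) :
    (prodBernoulli u).real ((openConn s a)ᶜ ∩ (openConn s b)ᶜ ∩ (openConn s c)ᶜ ∩ (openConn a b)ᶜ ∩ (openConn a c)ᶜ ∩ (openConn b c)ᶜ : Set (BondConfig V)) =
        (prodBernoulli u).real ((openConn c s)ᶜ ∩ (openConn c a)ᶜ ∩ (openConn c b)ᶜ : Set (BondConfig V)) ∧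
      (prodBernoulli u).real ((openConn s b)ᶜ ∩ (openConn s c)ᶜ ∩ (openConn a b)ᶜ ∩ (openConn a c)ᶜ ∩ (openConn b c)ᶜ : Set (BondConfig V)) =
        (prodBernoulli u).real ((openConn c s)ᶜ ∩ (openConn c a)ᶜ ∩ (openConn c b)ᶜ : Set (BondConfig V)) ∧
      (prodBernoulli u).real ((openConn s b)ᶜ ∩ (openConn s c)ᶜ ∩ (openConn a b)ᶜ ∩ (openConn a c)ᶜ : Set (BondConfig V)) =
        (prodBernoulli u).real ((openConn c s)ᶜ ∩ (openConn c a)ᶜ ∩ (openConn c b)ᶜ : Set (BondConfig V)) ∧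
      (prodBernoulli u).real ((openConn s a)ᶜ ∩ (openConn s b)ᶜ ∩ (openConn s c)ᶜ ∩ (openConn a b)ᶜ ∩ (openConn a c)ᶜ : Set (BondConfig V)) =
        (prodBernoulli u).real ((openConn c s)ᶜ ∩ (openConn c a)ᶜ ∩ (openConn c b)ᶜ : Set (BondConfig V)) ∧
      (prodBernoulli u).real ((openConn s b)ᶜ ∩ (openConn a b)ᶜ ∩ (openConn b c)ᶜ : Set (BondConfig V)) = 1 ∧
      (prodBernoulli u).real ((openConn s a)ᶜ ∩ (openConn s b)ᶜ ∩ (openConn a b)ᶜ ∩ (openConn a c)ᶜ ∩ (openConn b c)ᶜ : Set (BondConfig V)) =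
        (prodBernoulli u).real ((openConn c s)ᶜ ∩ (openConn c a)ᶜ ∩ (openConn c b)ᶜ : Set (BondConfig V)) ∧
      (prodBernoulli u).real ((openConn s a)ᶜ ∩ (openConn s b)ᶜ ∩ (openConn s c)ᶜ ∩ (openConn a b)ᶜ ∩ (openConn b c)ᶜ : Set (BondConfig V)) = 1 := by
  have hae : ∀ᵐ ω ∂(prodBernoulli u), (¬ (openGraph ω).Reachable s a ∧ ¬ (openGraph ω).Reachable a s) ∧
      (¬ (openGraph ω).Reachable s b ∧ ¬ (openGraph ω).Reachable b s) ∧ (¬ (openGraph ω).Reachable s c ∧ ¬ (openGraph ω).Reachable c s) ∧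
      (¬ (openGraph ω).Reachable b a ∧ ¬ (openGraph ω).Reachable a b) ∧ (¬ (openGraph ω).Reachable b c ∧ ¬ (openGraph ω).Reachable c b) := by
    filter_upwards [ae_sep_of_isolated u hs hd.1.symm, ae_sep_of_isolated u hs hd.2.1.symm, ae_sep_of_isolated u hs hd.2.2.1.symm,
      ae_sep_of_isolated u hb hd.2.2.2.1, ae_sep_of_isolated u hb hd.2.2.2.2.2.symm] with ω h1 h2 h3 h4 h5
    exact ⟨h1, h2, h3, h4, h5⟩
  have Y : ∀ X : Set (BondConfig V), (∀ ω : BondConfig V, ((¬ (openGraph ω).Reachable s a ∧ ¬ (openGraph ω).Reachable a s) ∧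
      (¬ (openGraph ω).Reachable s b ∧ ¬ (openGraph ω).Reachable b s) ∧ (¬ (openGraph ω).Reachable s c ∧ ¬ (openGraph ω).Reachable c s) ∧
      (¬ (openGraph ω).Reachable b a ∧ ¬ (openGraph ω).Reachable a b) ∧ (¬ (openGraph ω).Reachable b c ∧ ¬ (openGraph ω).Reachable c b)) →
      (ω ∈ X ↔ ¬ (openGraph ω).Reachable c a)) →
      (prodBernoulli u).real X = (prodBernoulli u).real ((openConn c s)ᶜ ∩ (openConn c a)ᶜ ∩ (openConn c b)ᶜ : Set (BondConfig V)) := by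
    intro X hX
    refine real_congr_of_ae u ?_
    filter_upwards [hae] with ω hω
    rw [hX ω hω]
    simp only [mem_inter_iff, mem_compl_iff, openConn, mem_setOf_eq]
    tauto
  have O : ∀ X : Set (BondConfig V), (∀ ω : BondConfig V, ((¬ (openGraph ω).Reachable s a ∧ ¬ (openGraph ω).Reachable a s) ∧
      (¬ (openGraph ω).Reachable s b ∧ ¬ (openGraph ω).Reachable b s) ∧ (¬ (openGraph ω).Reachable s c ∧ ¬ (openGraph ω).Reachable c s) ∧
      (¬ (openGraph ω).Reachable b a ∧ ¬ (openGraph ω).Reachable a b) ∧ (¬ (openGraph ω).Reachable b c ∧ ¬ (openGraph ω).Reachable c b)) →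
      ω ∈ X) → (prodBernoulli u).real X = 1 := fun X hX =>
    real_eq_one_of_ae u (by filter_upwards [hae] with ω hω; exact hX ω hω)
  have hac : ∀ ω : BondConfig V, (openGraph ω).Reachable a c ↔ (openGraph ω).Reachable c a := fun ω => ⟨fun h => h.symm, fun h => h.symm⟩
  refine ⟨Y _ ?_, Y _ ?_, Y _ ?_, Y _ ?_, O _ ?_, Y _ ?_, O _ ?_⟩ <;> intro ω hω <;>
    simp only [mem_inter_iff, mem_compl_iff, openConn, mem_setOf_eq, hac ω] <;> tauto

end Shapes

/-! ## The assembly -/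

section Pieces
variable {s a b c : V}

/-- **MAIN THEOREM: for `λ ≥ 3/2`, pieces touching the port and at most one terminal are irrelevant to `P3_λ` (together with the pieces not
touching the port).**  Let `s a b c` be pairwise distinct, `part : V → ι` a splitting of `w` along `{s,a,b,c}`, and `J` a set of labels such that
every piece `i ∉ J` misses the port (`w(c,v) = 0` on it), or misses `{s,a}`, or misses `{s,b}`, or misses `{a,b}`.  If the partial union
`w_J := w·1_{terminal pairs ∪ pieces of J}` satisfies the row, so does `w`. [this work] -/
theorem p3lam_of_portPieces₂ {ι : Type*} [Fintype ι] {lam : ℝ} (hlam : 3 / 2 ≤ lam) (w : Sym2 V → unitInterval)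
    (hd : s ≠ a ∧ s ≠ b ∧ s ≠ c ∧ a ≠ b ∧ a ≠ c ∧ b ≠ c) (part : V → ι)
    (hw : ∀ x y : V, x ∉ ({s, a, b, c} : Finset V) → y ∉ ({s, a, b, c} : Finset V) → part x ≠ part y → (w s(x, y) : ℝ) = 0)
    (J : Finset ι) (hJ : ∀ i, i ∉ J →
      (∀ v : V, v ∉ ({s, a, b, c} : Finset V) → part v = i → (w s(c, v) : ℝ) = 0) ∨
      (∀ v : V, v ∉ ({s, a, b, c} : Finset V) → part v = i → (w s(s, v) : ℝ) = 0 ∧ (w s(a, v) : ℝ) = 0) ∨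
      (∀ v : V, v ∉ ({s, a, b, c} : Finset V) → part v = i → (w s(a, v) : ℝ) = 0 ∧ (w s(b, v) : ℝ) = 0) ∨
      (∀ v : V, v ∉ ({s, a, b, c} : Finset V) → part v = i → (w s(s, v) : ℝ) = 0 ∧ (w s(b, v) : ℝ) = 0))
    (hrow :
      (prodBernoulli fun e => if e ∈ ({s, a, b, c} : Finset V).sym2 ∨ ∃ i ∈ J, e ∈ piecePairs {s, a, b, c} part i then w e else 0).real
          (openConn s a ∩ (openConn s b)ᶜ : Set (BondConfig V)) *
        (prodBernoulli fun e => if e ∈ ({s, a, b, c} : Finset V).sym2 ∨ ∃ i ∈ J, e ∈ piecePairs {s, a, b, c} part i then w e else 0).real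
          ((openConn c s)ᶜ ∩ (openConn c a)ᶜ ∩ (openConn c b)ᶜ : Set (BondConfig V))ᶜ ≤
      lam * (prodBernoulli fun e => if e ∈ ({s, a, b, c} : Finset V).sym2 ∨ ∃ i ∈ J, e ∈ piecePairs {s, a, b, c} part i
          then w e else 0).real
          (openConn s a ∩ (openConn s b)ᶜ ∩ ((openConn c s)ᶜ ∩ (openConn c a)ᶜ ∩ (openConn c b)ᶜ)ᶜ : Set (BondConfig V))) :
    (prodBernoulli w).real (openConn s a ∩ (openConn s b)ᶜ : Set (BondConfig V)) *
        (prodBernoulli w).real ((openConn c s)ᶜ ∩ (openConn c a)ᶜ ∩ (openConn c b)ᶜ : Set (BondConfig V))ᶜ ≤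
      lam * (prodBernoulli w).real (openConn s a ∩ (openConn s b)ᶜ ∩ ((openConn c s)ᶜ ∩ (openConn c a)ᶜ ∩ (openConn c b)ᶜ)ᶜ : Set (BondConfig V)) := by
  -- abbreviations: the terminal piece and the pieces
  set w₀ : Sym2 V → unitInterval := fun e => if e ∈ ({s, a, b, c} : Finset V).sym2 then w e else 0 with hw₀
  set wp : ι → Sym2 V → unitInterval := fun i e => if e ∈ piecePairs {s, a, b, c} part i then w e else 0 with hwp
  -- transfer of 'the pairs of the piece at terminal `t` vanish' to the piece weight
  have htr : ∀ (i : ι) (t : V), t ∈ ({s, a, b, c} : Finset V) →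
      (∀ v : V, v ∉ ({s, a, b, c} : Finset V) → part v = i → (w s(t, v) : ℝ) = 0) →
      ∀ x : V, x ≠ t → ((wp i) s(t, x) : ℝ) = 0 := by
    intro i t ht hzero x hx
    by_cases hmem : s(t, x) ∈ piecePairs ({s, a, b, c} : Finset V) part i
    · obtain ⟨u, v, ⟨hu, hui⟩, -, -, he⟩ := mem_piecePairs.1 hmem
      rcases Sym2.eq_iff.1 he with ⟨h1, -⟩ | ⟨-, h2⟩
      · exact absurd (h1 ▸ ht) hu
      · have hxT : x ∉ ({s, a, b, c} : Finset V) := h2 ▸ hu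
        have hpx : part x = i := by rw [h2, hui]
        have h0 := hzero x hxT hpx
        simp only [hwp, if_pos hmem]
        exact h0
    · simp only [hwp, if_neg hmem]
      rfl
  have hsT : s ∈ ({s, a, b, c} : Finset V) := by simp
  have haT : a ∈ ({s, a, b, c} : Finset V) := by simp
  have hbT : b ∈ ({s, a, b, c} : Finset V) := by simp
  have hcT : c ∈ ({s, a, b, c} : Finset V) := by simp
  have Cp := fun i => core_of_weight (wp i) s a b c
  -- induction over sets `S` of pieces outside `J`: the vector `D(w₀)·∏_{i ∈ J ∪ S} D(wᵢ)` (= `D(w_{J ∪ S})`) satisfies the row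
  have key : ∀ S : Finset ι, (∀ i ∈ S, i ∉ J) →
      RowLam[lam;
        (prodBernoulli w₀).real ((openConn s a)ᶜ ∩ (openConn s b)ᶜ ∩ (openConn s c)ᶜ ∩ (openConn a b)ᶜ ∩ (openConn a c)ᶜ ∩ (openConn b c)ᶜ) *
          ∏ i ∈ J ∪ S, (prodBernoulli (wp i)).real
            ((openConn s a)ᶜ ∩ (openConn s b)ᶜ ∩ (openConn s c)ᶜ ∩ (openConn a b)ᶜ ∩ (openConn a c)ᶜ ∩ (openConn b c)ᶜ),
        (prodBernoulli w₀).real ((openConn s b)ᶜ ∩ (openConn s c)ᶜ ∩ (openConn a b)ᶜ ∩ (openConn a c)ᶜ ∩ (openConn b c)ᶜ) *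
          ∏ i ∈ J ∪ S, (prodBernoulli (wp i)).real ((openConn s b)ᶜ ∩ (openConn s c)ᶜ ∩ (openConn a b)ᶜ ∩ (openConn a c)ᶜ ∩ (openConn b c)ᶜ),
        (prodBernoulli w₀).real ((openConn s b)ᶜ ∩ (openConn s c)ᶜ ∩ (openConn a b)ᶜ ∩ (openConn a c)ᶜ) *
          ∏ i ∈ J ∪ S, (prodBernoulli (wp i)).real ((openConn s b)ᶜ ∩ (openConn s c)ᶜ ∩ (openConn a b)ᶜ ∩ (openConn a c)ᶜ),
        (prodBernoulli w₀).real ((openConn s a)ᶜ ∩ (openConn s b)ᶜ ∩ (openConn s c)ᶜ ∩ (openConn a b)ᶜ ∩ (openConn a c)ᶜ) *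
          ∏ i ∈ J ∪ S, (prodBernoulli (wp i)).real ((openConn s a)ᶜ ∩ (openConn s b)ᶜ ∩ (openConn s c)ᶜ ∩ (openConn a b)ᶜ ∩ (openConn a c)ᶜ),
        (prodBernoulli w₀).real ((openConn s b)ᶜ ∩ (openConn a b)ᶜ ∩ (openConn b c)ᶜ) *
          ∏ i ∈ J ∪ S, (prodBernoulli (wp i)).real ((openConn s b)ᶜ ∩ (openConn a b)ᶜ ∩ (openConn b c)ᶜ),
        (prodBernoulli w₀).real ((openConn s a)ᶜ ∩ (openConn s b)ᶜ ∩ (openConn a b)ᶜ ∩ (openConn a c)ᶜ ∩ (openConn b c)ᶜ) *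
          ∏ i ∈ J ∪ S, (prodBernoulli (wp i)).real ((openConn s a)ᶜ ∩ (openConn s b)ᶜ ∩ (openConn a b)ᶜ ∩ (openConn a c)ᶜ ∩ (openConn b c)ᶜ),
        (prodBernoulli w₀).real ((openConn s a)ᶜ ∩ (openConn s b)ᶜ ∩ (openConn s c)ᶜ ∩ (openConn a b)ᶜ ∩ (openConn b c)ᶜ) *
          ∏ i ∈ J ∪ S, (prodBernoulli (wp i)).real ((openConn s a)ᶜ ∩ (openConn s b)ᶜ ∩ (openConn s c)ᶜ ∩ (openConn a b)ᶜ ∩ (openConn b c)ᶜ),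
        (prodBernoulli w₀).real ((openConn c s)ᶜ ∩ (openConn c a)ᶜ ∩ (openConn c b)ᶜ) *
          ∏ i ∈ J ∪ S, (prodBernoulli (wp i)).real ((openConn c s)ᶜ ∩ (openConn c a)ᶜ ∩ (openConn c b)ᶜ)] := by
    intro S
    induction S using Finset.induction_on with
    | empty =>
      intro _
      -- the hypothesis on `w_J`, in down-set coordinates, split along `J`
      have GJ := (rowLam_iff (fun e => if e ∈ ({s, a, b, c} : Finset V).sym2 ∨ ∃ i ∈ J, e ∈ piecePairs {s, a, b, c} part i
        then w e else 0) lam s a b c).1 hrow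
      have pu := fun blk : V → ℕ => real_partLE_partialUnion w ({s, a, b, c} : Finset V) part hw J blk
      rw [← partLE_blk0 hd, ← partLE_blk1 hd, ← partLE_blk2 hd, ← partLE_blk3 hd, ← partLE_blk4 hd, ← partLE_blk5 hd,
        ← partLE_blk6 hd, ← partLE_blk7 hd] at GJ
      simp only [pu] at GJ
      rw [partLE_blk0 hd, partLE_blk1 hd, partLE_blk2 hd, partLE_blk3 hd, partLE_blk4 hd, partLE_blk5 hd, partLE_blk6 hd,
        partLE_blk7 hd] at GJ
      simpa only [Finset.union_empty] using GJ
    | @insert j S hj ih =>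
      intro hS
      have hjJ : j ∉ J := hS j (Finset.mem_insert_self j S)
      have IH := ih fun i hi => hS i (Finset.mem_insert_of_mem hi)
      -- the partial union `w_{J ∪ S}` is a weighted graph: order relations and face inequality for `D(w₀)·∏_{i∈J∪S} D(wᵢ)`
      have pu := fun blk : V → ℕ => real_partLE_partialUnion w ({s, a, b, c} : Finset V) part hw (J ∪ S) blk
      have CS := core_of_weight (fun e => if e ∈ ({s, a, b, c} : Finset V).sym2 ∨ ∃ i ∈ J ∪ S, e ∈ piecePairs {s, a, b, c} part i
        then w e else 0) s a b c
      have FS := face_of_weight (fun e => if e ∈ ({s, a, b, c} : Finset V).sym2 ∨ ∃ i ∈ J ∪ S, e ∈ piecePairs {s, a, b, c} part i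
        then w e else 0) hd
      rw [← partLE_blk0 hd, ← partLE_blk1 hd, ← partLE_blk2 hd, ← partLE_blk3 hd, ← partLE_blk4 hd, ← partLE_blk5 hd,
        ← partLE_blk6 hd, ← partLE_blk7 hd] at CS
      rw [← partLE_blk1 hd, ← partLE_blk2 hd, ← partLE_blk4 hd, ← partLE_blk7 hd] at FS
      simp only [pu] at CS FS
      rw [partLE_blk0 hd, partLE_blk1 hd, partLE_blk2 hd, partLE_blk3 hd, partLE_blk4 hd, partLE_blk5 hd, partLE_blk6 hd,
        partLE_blk7 hd] at CS
      rw [partLE_blk1 hd, partLE_blk2 hd, partLE_blk4 hd, partLE_blk7 hd] at FS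
      have hu : J ∪ insert j S = insert j (J ∪ S) := Finset.union_insert j J S
      have hj' : j ∉ J ∪ S := by
        rw [Finset.mem_union, not_or]; exact ⟨hjJ, hj⟩
      have r : ∀ (x : ℝ) (y : ι → ℝ), x * ∏ i ∈ J ∪ insert j S, y i = x * (∏ i ∈ J ∪ S, y i) * y j := fun x y => by
        rw [hu, Finset.prod_insert hj']; ring
      simp only [r]
      -- the new piece: port-free, or of `cb` / `cs` / `ca` shape
      have hlam' : 4 / 3 ≤ lam := by linarith
      obtain ⟨g0, g1, g3, g5, g6, g7, g71, gζ, gτ⟩ := Cp j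
      rcases hJ j hjJ with h0 | h1 | h2 | h3
      · obtain ⟨q2, q3, q4, q5, q6, q7⟩ := dvec_portIsolated (wp j) hd (htr j c hcT h0)
        exact dvec_p3lam_mul_portIsolated hlam CS IH FS q2 q3 q4 q5 q6 q7 g0 g1
      · obtain ⟨q0, q1, q2, q3, q4, q5, q6⟩ := dvec_cbPiece (wp j) hd (htr j s hsT fun v hv hpv => (h1 v hv hpv).1)
          (htr j a haT fun v hv hpv => (h1 v hv hpv).2)
        exact dvec_p3lam_mul_cbShape hlam' CS IH q0 q1 q2 q3 q4 q5 q6 g7 g71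
      · obtain ⟨q0, q1, q2, q3, q4, q5, q6⟩ := dvec_csPiece (wp j) hd (htr j a haT fun v hv hpv => (h2 v hv hpv).1)
          (htr j b hbT fun v hv hpv => (h2 v hv hpv).2)
        exact dvec_p3lam_mul_csShape hlam' CS IH q0 q1 q2 q3 q4 q5 q6 g7 g71
      · obtain ⟨q0, q1, q2, q3, q4, q5, q6⟩ := dvec_caPiece (wp j) hd (htr j s hsT fun v hv hpv => (h3 v hv hpv).1)
          (htr j b hbT fun v hv hpv => (h3 v hv hpv).2)
        exact dvec_p3lam_mul_caShape hlam' CS IH q0 q1 q2 q3 q4 q5 q6 g7 g71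
  -- at `S = univ ∖ J` the vector is `D(w)` by the splitting formula
  set S : Finset ι := Finset.univ.filter fun i => i ∉ J with hSdef
  have hS : ∀ i ∈ S, i ∉ J := fun i hi => (Finset.mem_filter.1 hi).2
  have hJS : J ∪ S = Finset.univ := by
    ext i
    simp only [Finset.mem_union, Finset.mem_univ, iff_true, hSdef, Finset.mem_filter, true_and]
    exact em _
  have K := key S hS
  rw [hJS] at K
  have S0 := real_partLE_eq_terminalPiece_mul_prod w ({s, a, b, c} : Finset V) part
    (fun v => if v = a then 1 else if v = b then 2 else if v = c then 3 else (0 : ℕ)) hw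
  have S1 := real_partLE_eq_terminalPiece_mul_prod w ({s, a, b, c} : Finset V) part
    (fun v => if v = b then 1 else if v = c then 2 else (0 : ℕ)) hw
  have S2 := real_partLE_eq_terminalPiece_mul_prod w ({s, a, b, c} : Finset V) part
    (fun v => if v = b ∨ v = c then 1 else (0 : ℕ)) hw
  have S3 := real_partLE_eq_terminalPiece_mul_prod w ({s, a, b, c} : Finset V) part
    (fun v => if v = a then 1 else if v = b ∨ v = c then 2 else (0 : ℕ)) hw
  have S4 := real_partLE_eq_terminalPiece_mul_prod w ({s, a, b, c} : Finset V) part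
    (fun v => if v = b then 1 else (0 : ℕ)) hw
  have S5 := real_partLE_eq_terminalPiece_mul_prod w ({s, a, b, c} : Finset V) part
    (fun v => if v = a then 1 else if v = b then 2 else (0 : ℕ)) hw
  have S6 := real_partLE_eq_terminalPiece_mul_prod w ({s, a, b, c} : Finset V) part
    (fun v => if v = a ∨ v = c then 1 else if v = b then 2 else (0 : ℕ)) hw
  have S7 := real_partLE_eq_terminalPiece_mul_prod w ({s, a, b, c} : Finset V) part
    (fun v => if v = c then 1 else (0 : ℕ)) hw
  rw [partLE_blk0 hd] at S0
  rw [partLE_blk1 hd] at S1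
  rw [partLE_blk2 hd] at S2
  rw [partLE_blk3 hd] at S3
  rw [partLE_blk4 hd] at S4
  rw [partLE_blk5 hd] at S5
  rw [partLE_blk6 hd] at S6
  rw [partLE_blk7 hd] at S7
  rw [← S0, ← S1, ← S2, ← S3, ← S4, ← S5, ← S6, ← S7] at K
  exact (rowLam_iff w lam s a b c).2 K

end Pieces

end Summit.CriticalPhenomena.PercolationContinuityZ3.Theorems.SuperTerminalP3LamPortPiecesTwo
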